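import Literature.Geometry.Riemannian.MeanConvexRegularDomain
import Literature.Geometry.Riemannian.MeanConvexContractibleTransport
import Literature.Geometry.Riemannian.MeanConvexContractible
import HarnessLib

/-!
# Sweeney's Prop. 1.2 reduced to the realisation of contractible manifolds as mean-convex domains
(topic `Geometry/Riemannian`)

Summary file of the proof series for the named fact
`Literature.Geometry.Riemannian.Sweeney2026_pscMeanConvex` (`MeanConvexContractible.lean`;
Sweeney 2026, Prop. 1.2): the GEOMETRIC half of the printed proof is formalised
(`MeanConvexContractibleProofs.lean`, `SphericalCapMap.lean`, `SphericalCapNormal.lean`,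
`MeanConvexContractibleDisc.lean`, `MeanConvexContractibleDiffeoBall.lean`,
`MeanConvexContractibleTransport.lean`, `HypersurfaceConformal.lean`,
`StereographicConformal.lean`, `MeanConvexEuclideanImmersion.lean`, `LevelSetMeanCurvature.lean`,
`MeanConvexRegularDomain.lean`), and `Sweeney2026_pscMeanConvex_of_domainRealisation` derives the
fact from the remaining TOPOLOGICAL input, stated as an explicit hypothesis (and
`Sweeney2026_pscMeanConvex_of_cases` splits that input into its three classical pieces,
`n = 2` / `n = 3` / `n ≥ 4`): every compact
contractible `(n+1)`-manifold with boundary (`n ≥ 2`; a Mazur manifold if `n = 3`) is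
diffeomorphic to a regular compact domain `{F ≤ 0} ⊂ ℝⁿ⁺¹` with Lawson–Michelsohn mean-convex
boundary (`∑ᵢ Hess F(vᵢ, vᵢ) > 0` on orthonormal frames of `ker dF`) — Lawson–Michelsohn's
surrounding and handle theorems (Invent. Math. 77 (1984), (1.4), (6.1), Thms. 3–4; tree fact
`LawsonMichelsohn1984_surrounding` for the Euclidean case) applied to an embedding
`X ↪ ℝⁿ⁺¹` (h-cobordism theorem for `n ≥ 4`, the Mazur structure for `n = 3`, Poincaré for
`n = 2`). PROVED; no definitions, no named facts.

## References

* P. Sweeney Jr., *Positive curvature conditions on contractible manifolds*, Math. Ann. (2026)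
  = arXiv:2507.15719, Prop. 1.2 and its proof (p. 4). [Sweeney2026]
* H. B. Lawson, M.-L. Michelsohn, *Embedding and surrounding with positive mean curvature*,
  Invent. Math. 77 (1984) 399–419, (1.4), Thm. (6.1), Thms. 3–4. [LawsonMichelsohn1984]
-/

noncomputable section

open Bundle Set Function Metric Module Filter
open scoped Manifold ContDiff Topology RealInnerProductSpace

namespace Literature.Geometry.Riemannian

open Lorentzian Lorentzian.PseudoRiemannianMetric Literature.Topology.FourManifolds
  IsRegularCompactDomain

/-- **Sweeney's Proposition 1.2 from the realisation of compact contractible manifolds as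
Lawson–Michelsohn domains.** The proof of Prop. 1.2 printed in Sweeney 2026 (p. 4) has a
topological half and a geometric half. TOPOLOGICAL HALF (the hypothesis `hreal`, not formalised
here): a compact contractible `(n+1)`-manifold with boundary `X`, `n ≥ 2` (for `n = 3` a Mazur
manifold), is diffeomorphic to a regular compact domain `{F ≤ 0} ⊂ ℝⁿ⁺¹` whose boundary has
positive mean curvature in Lawson–Michelsohn's sense, `∑ᵢ Hess F_x(vᵢ, vᵢ) > 0` on orthonormal
frames of `ker dF_x` — for `n ≥ 4`: `X` embeds in `Sⁿ⁺¹` minus a point (h-cobordism theorem), is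
`1`-thin (`π₁(X, ∂X) = 0` as `X` is contractible, `π₁ ∂X → π₁ X` onto), so Lawson–Michelsohn's
surrounding theorem (Invent. Math. 77 (1984), Thm. (6.1) = (1.4); the tree's fact
`LawsonMichelsohn1984_surrounding`) isotopes `∂X` to a mean-convex hypersurface and the isotopy
extends ambiently; for `n = 3`: Lawson–Michelsohn's handle theorems 3–4 on the Mazur handle
decomposition; for `n = 2`: `X ≅ D³` (Poincaré). GEOMETRIC HALF (proved in this series of files):
such a domain carries a metric of positive scalar curvature with mean-convex boundary relative to
any boundary datum (`pscMeanConvex_of_hessianMeanConvexDomain`: unit gradient normal, outwardness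
through the straightening chart, uniform Hessian bound, big-sphere conformal trick
`pscMeanConvex_of_flatMeanConvexImmersion`, round-sphere pull-back `pscMeanConvex_of_immersion`),
and the conclusion transports along the diffeomorphism (`pscMeanConvex_of_diffeomorph`). Hence
the named fact `Sweeney2026_pscMeanConvex` follows from `hreal`. [cite: Sweeney2026, Prop. 1.2] -/
theorem Sweeney2026_pscMeanConvex_of_domainRealisation
    (hreal : ∀ n : ℕ, 2 ≤ n → ∀ (X : Type) [TopologicalSpace X] [T2Space X]
      [SecondCountableTopology X] [ChartedSpace (EuclideanHalfSpace (n + 1)) X]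
      [IsManifold (𝓡∂ (n + 1)) ∞ X] [CompactSpace X] [ContractibleSpace X],
      (n = 3 → HasHandleDecomposition n X (fun k => if k ≤ 2 then 1 else 0)) →
      ∃ (F : EuclideanSpace ℝ (Fin (n + 1)) → ℝ) (h : IsRegularCompactDomain F),
        (∀ x, F x = 0 → ∀ v : Fin n → EuclideanSpace ℝ (Fin (n + 1)), Orthonormal ℝ v →
          (∀ i, fderiv ℝ F x (v i) = 0) → 0 < ∑ i, iteratedFDeriv ℝ 2 F x ![v i, v i]) ∧
        Nonempty (X ≃ₘ⟮𝓡∂ (n + 1), 𝓡∂ (n + 1)⟯ h.Domain)) :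
    Sweeney2026_pscMeanConvex := by
  intro n hn X _ _ _ _ _ _ _ bX h3
  obtain ⟨F, h, hH, ⟨Ψ⟩⟩ := hreal n hn X h3
  have hm : 1 ≤ n := by omega
  exact pscMeanConvex_of_diffeomorph n bX Ψ
    (pscMeanConvex_of_hessianMeanConvexDomain hm h hH (boundaryDataPushforward bX Ψ))

/-- **Sweeney's Proposition 1.2, case by case, from its three topological inputs.** The fact
`Sweeney2026_pscMeanConvex` follows from: (`n = 2`) every compact contractible `3`-manifold
with boundary is a `3`-disc (Poincaré–Perelman + Alexander; then
`pscMeanConvex_of_diffeomorph_closedBall`); (`n = 3`) every Mazur `4`-manifold (one `0`-, `1`-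
and `2`-handle) is diffeomorphic to a regular compact domain of `ℝ⁴` with Lawson–Michelsohn
mean-convex boundary (Lawson–Michelsohn 1984, Thms. 3–4, as used by Sweeney); (`n ≥ 4`) every
compact contractible `(n+1)`-manifold with boundary is diffeomorphic to such a domain of `ℝⁿ⁺¹`
(embedding via the h-cobordism theorem, `1`-thinness, Lawson–Michelsohn (1.4)/(6.1) =
`LawsonMichelsohn1984_surrounding`, ambient isotopy extension) — the last two fed into the proved
geometric half (`pscMeanConvex_of_hessianMeanConvexDomain`, `pscMeanConvex_of_diffeomorph`).
[cite: Sweeney2026, Prop. 1.2] -/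
theorem Sweeney2026_pscMeanConvex_of_cases
    (h₂ : ∀ (X : Type) [TopologicalSpace X] [T2Space X] [SecondCountableTopology X]
      [ChartedSpace (EuclideanHalfSpace (2 + 1)) X] [IsManifold (𝓡∂ (2 + 1)) ∞ X] [CompactSpace X]
      [ContractibleSpace X],
        Nonempty (X ≃ₘ⟮𝓡∂ (2 + 1), 𝓡∂ (2 + 1)⟯
          (Metric.closedBall (0 : EuclideanSpace ℝ (Fin (2 + 1))) 1)))
    (h₃ : ∀ (X : Type) [TopologicalSpace X] [T2Space X] [SecondCountableTopology X]
      [ChartedSpace (EuclideanHalfSpace (3 + 1)) X] [IsManifold (𝓡∂ (3 + 1)) ∞ X] [CompactSpace X]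
      [ContractibleSpace X],
      HasHandleDecomposition 3 X (fun k => if k ≤ 2 then 1 else 0) →
      ∃ (F : EuclideanSpace ℝ (Fin (3 + 1)) → ℝ) (h : IsRegularCompactDomain F),
        (∀ x, F x = 0 → ∀ v : Fin 3 → EuclideanSpace ℝ (Fin (3 + 1)), Orthonormal ℝ v →
          (∀ i, fderiv ℝ F x (v i) = 0) → 0 < ∑ i, iteratedFDeriv ℝ 2 F x ![v i, v i]) ∧
        Nonempty (X ≃ₘ⟮𝓡∂ (3 + 1), 𝓡∂ (3 + 1)⟯ h.Domain))
    (h₄ : ∀ n : ℕ, 4 ≤ n → ∀ (X : Type) [TopologicalSpace X] [T2Space X]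
      [SecondCountableTopology X] [ChartedSpace (EuclideanHalfSpace (n + 1)) X]
      [IsManifold (𝓡∂ (n + 1)) ∞ X] [CompactSpace X] [ContractibleSpace X],
      ∃ (F : EuclideanSpace ℝ (Fin (n + 1)) → ℝ) (h : IsRegularCompactDomain F),
        (∀ x, F x = 0 → ∀ v : Fin n → EuclideanSpace ℝ (Fin (n + 1)), Orthonormal ℝ v →
          (∀ i, fderiv ℝ F x (v i) = 0) → 0 < ∑ i, iteratedFDeriv ℝ 2 F x ![v i, v i]) ∧
        Nonempty (X ≃ₘ⟮𝓡∂ (n + 1), 𝓡∂ (n + 1)⟯ h.Domain)) :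
    Sweeney2026_pscMeanConvex := by
  intro n hn X _ _ _ _ _ _ _ bX h3
  rcases Nat.lt_or_ge n 4 with hlt | hge
  · interval_cases n
    · obtain ⟨Ψ⟩ := h₂ X
      exact pscMeanConvex_of_diffeomorph_closedBall (n := 2) (by norm_num) bX Ψ
    · obtain ⟨F, h, hH, ⟨Ψ⟩⟩ := h₃ X (h3 rfl)
      exact pscMeanConvex_of_diffeomorph 3 bX Ψ
        (pscMeanConvex_of_hessianMeanConvexDomain (by norm_num) h hH (boundaryDataPushforward bX Ψ))
  · obtain ⟨F, h, hH, ⟨Ψ⟩⟩ := h₄ n hge X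
    exact pscMeanConvex_of_diffeomorph n bX Ψ
      (pscMeanConvex_of_hessianMeanConvexDomain (by omega) h hH (boundaryDataPushforward bX Ψ))

end Literature.Geometry.Riemannian

end
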